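import Literature.Analysis.FluidPDE.KNSSMildDecayProofs
import Literature.Analysis.FluidPDE.OseenDuhamelHeatDecay
import Literature.Analysis.FluidPDE.SteadyStrainedNS
import HarnessLib

/-!
# Bounded steady Navier–Stokes flows on `ℝ³` are Oseen-mild

Analysis/FluidPDE proof file (theorems only; no named fact). A steady classical solution
`(W, P)` of the unforced Navier–Stokes system at unit viscosity on `ℝ³`
(`IsSteadyClassicalNS 1 0 W P`: `W`, `P` smooth, `(W·∇)W = ΔW − ∇P`, `div W = 0`) with
**bounded velocity** `‖W‖ ≤ M` — no hypothesis on the pressure — solves Oseen's integral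
equation from its own datum: `W = e^{τΔ}W − B¹₀(W, W)(τ)` for all `τ > 0`, pointwise
(`IsSteadyClassicalNS.eq_heatExtension_sub_oseenDuhamel`; `B¹₀ = oseenDuhamel 1 0`,
`NSBoundedMildOseen.lean`; the proof is exposed for continuous bounded steady WEAK solutions as
`eq_heatExtension_sub_oseenDuhamel_of_isBoundedWeakNSSolutionOn`, used for `C²/C¹` steady
solutions in `SteadyNSClassicalRegularity.lean`). Steady twin of `mild_of_bounded_of_eLpNorm_two_le_of_lt`
(finite energy) and `mild_of_rMulNorm_bounded_of_lt` (decay at horizontal infinity,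
Koch–Nadirashvili–Seregin–Šverák 2009, Thm 6.1); the proof is theirs but for the drift kill:

1. the constant-in-time pair is classical on `ℝ³ × (0, T)` (`isSteadyClassicalNS_iff_const`),
   bounded, hence bounded weak (`IsClassicalNSSolutionOn.isBoundedWeakNSSolutionOn`), and
   KNSS's Lemma 3.1 (`KNSS2009_weak_driftMild_holds`) writes `W = U(t) + b(t)` a.e. for a.e.
   `t`, `U` drift-mild; at good initial times `r`, `U(t') = Φ(t' − r) − b(r)` with the
   drift-free field `Φ(τ) = e^{τΔ}W − B¹₀(W,W)(τ)` (`oseenDuhamel_translate`);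
2. **steady drift kill**: for good times `r₁, r₂` and a later `t'`, the constant
   `c = b(r₂) − b(r₁)` is `Φ(t' − r₂) − Φ(t' − r₁)` identically in `x`; under the heat flow
   `e^{σΔ}`, `σ → ∞`, `e^{σΔ}c = c`, the Duhamel pieces decay like `σ^{-1/2}`
   (`exists_norm_heatExtension_oseenDuhamel_le_of_bound`) and
   `e^{(τ₂+σ)Δ}W − e^{(τ₁+σ)Δ}W → 0` for bounded `W` by the large-time `L¹`-continuity of the
   Gauss–Weierstrass kernel `∫|G_s − G_{s'}| ≤ 2(1 − (s/s')^{n/2})`, `s ≤ s'`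
   (`integral_abs_heatKernel_sub_le`, proved here): `c = 0` (KNSS 2009, §1 p. 3: the
   parasitic solutions `b(t)`, `∇p = −b'(t)·x` are excluded for steady bounded fields);
3. at good pairs `W = Φ(t' − r)` a.e., hence everywhere (continuity), and every `τ ∈ (0, T)`
   is a difference of two good times (translation invariance of Lebesgue measure).

Consumed by `SteadyNSBoundedAnalytic.lean` (real-analyticity of bounded steady flows).

## References

* G. Koch, N. Nadirashvili, G. Seregin, V. Šverák, *Liouville theorems for the Navier–Stokes
  equations and applications*, Acta Math. 203 (2009) 83–105 = arXiv:0709.3599, §1 p. 3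
  (parasitic solutions), §3 Lemma 3.1, §4 (ii) p. 8. [KochNadirashviliSereginSverak2009]
* P. G. Lemarié-Rieusset, *The Navier–Stokes Problem in the 21st Century*, CRC Press 2016,
  Thm. 6.1 / Prop. 6.5 (Oseen solutions). [LemarieRieusset2016]
-/

noncomputable section

open MeasureTheory Set Function Filter TopologicalSpace InnerProductSpace Metric
open _root_.Topology
open scoped ENNReal NNReal RealInnerProductSpace ContDiff

namespace Literature.Analysis.FluidPDE

open UnboundedOperators (heatKernel heatExtension)

/-! ### Large-time `L¹`-continuity of the Gauss–Weierstrass kernel -/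

section HeatKernel

variable {E : Type*} [NormedAddCommGroup E] [InnerProductSpace ℝ E] [FiniteDimensional ℝ E]
  [MeasurableSpace E] [BorelSpace E]
variable {F : Type*} [NormedAddCommGroup F] [NormedSpace ℝ F]

omit [FiniteDimensional ℝ E] [MeasurableSpace E] [BorelSpace E] in
/-- **Monotonicity of the Gauss–Weierstrass kernel in time, up to the normalisation**:
`(s/s')^{n/2} G_s(y) ≤ G_{s'}(y)` for `0 < s ≤ s'` (`n = dim E`): the Gaussian factor increases
with time and the prefactors differ by `(s/s')^{n/2}`. [folklore] -/
theorem rpow_mul_heatKernel_le_heatKernel {s s' : ℝ} (hs : 0 < s) (hss' : s ≤ s') (y : E) :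
    (s / s') ^ ((Module.finrank ℝ E : ℝ) / 2) * heatKernel s y ≤ heatKernel s' y := by
  have hs' : 0 < s' := hs.trans_le hss'
  set e : ℝ := (Module.finrank ℝ E : ℝ) / 2 with he
  have hneg : -(Module.finrank ℝ E : ℝ) / 2 = -e := by rw [he]; ring
  have hq : 0 < s / s' := div_pos hs hs'
  -- the prefactors
  have hpre : (s / s') ^ e * (4 * Real.pi * s) ^ (-e) = (4 * Real.pi * s') ^ (-e) := by
    have hsplit : 4 * Real.pi * s = (4 * Real.pi * s') * (s / s') := by
      field_simp
    rw [hsplit, Real.mul_rpow (by positivity) hq.le, ← mul_assoc, mul_comm ((s / s') ^ e),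
      mul_assoc, ← Real.rpow_add hq, add_neg_cancel, Real.rpow_zero, mul_one]
  -- the Gaussian factors
  have hexp : Real.exp (-‖y‖ ^ 2 / (4 * s)) ≤ Real.exp (-‖y‖ ^ 2 / (4 * s')) := by
    rw [Real.exp_le_exp, neg_div, neg_div, neg_le_neg_iff]
    exact div_le_div_of_nonneg_left (sq_nonneg _) (by positivity) (by linarith)
  have hK : ∀ t : ℝ, heatKernel t y = (4 * Real.pi * t) ^ (-e) * Real.exp (-‖y‖ ^ 2 / (4 * t)) := by
    intro t
    unfold UnboundedOperators.heatKernel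
    rw [hneg]
  rw [hK s, hK s', ← hpre]
  calc (s / s') ^ e * ((4 * Real.pi * s) ^ (-e) * Real.exp (-‖y‖ ^ 2 / (4 * s)))
      = ((s / s') ^ e * (4 * Real.pi * s) ^ (-e)) * Real.exp (-‖y‖ ^ 2 / (4 * s)) := by ring
    _ ≤ ((s / s') ^ e * (4 * Real.pi * s) ^ (-e)) * Real.exp (-‖y‖ ^ 2 / (4 * s')) :=
        mul_le_mul_of_nonneg_left hexp (by positivity)

/-- **Large-time `L¹`-continuity of the Gauss–Weierstrass kernel**: for `0 < s ≤ s'`,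
`∫ |G_s − G_{s'}| ≤ 2 (1 − (s/s')^{n/2})` (pointwise `|G_s − G_{s'}| ≤ G_s + G_{s'} − 2(s/s')^{n/2}G_s`
by `rpow_mul_heatKernel_le_heatKernel`, and `∫ G = 1`). [folklore] -/
theorem integral_abs_heatKernel_sub_le {s s' : ℝ} (hs : 0 < s) (hss' : s ≤ s') :
    ∫ y : E, |heatKernel s y - heatKernel s' y| ≤
      2 * (1 - (s / s') ^ ((Module.finrank ℝ E : ℝ) / 2)) := by
  have hs' : 0 < s' := hs.trans_le hss'
  set ρ : ℝ := (s / s') ^ ((Module.finrank ℝ E : ℝ) / 2) with hρ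
  have hρ1 : ρ ≤ 1 :=
    Real.rpow_le_one (div_pos hs hs').le ((div_le_one hs').2 hss') (by positivity)
  have hpt : ∀ y : E, |heatKernel s y - heatKernel s' y| ≤
      heatKernel s y + heatKernel s' y - 2 * (ρ * heatKernel s y) := by
    intro y
    have h0 : 0 ≤ heatKernel s y := (UnboundedOperators.heatKernel_pos hs y).le
    have h1 : ρ * heatKernel s y ≤ heatKernel s' y := rpow_mul_heatKernel_le_heatKernel hs hss' y
    have h2 : ρ * heatKernel s y ≤ heatKernel s y := mul_le_of_le_one_left h0 hρ1
    rw [abs_sub_le_iff]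
    constructor <;> linarith
  have hi : Integrable (heatKernel (E := E) s) := UnboundedOperators.integrable_heatKernel_holds hs
  have hi' : Integrable (heatKernel (E := E) s') := UnboundedOperators.integrable_heatKernel_holds hs'
  have hsum : Integrable (fun y : E => heatKernel s y + heatKernel s' y) := hi.add hi'
  have habs : Integrable (fun y : E => |heatKernel s y - heatKernel s' y|) := (hi.sub hi').abs
  have h2ρ : Integrable (fun y : E => 2 * (ρ * heatKernel s y)) := (hi.const_mul ρ).const_mul 2
  calc ∫ y : E, |heatKernel s y - heatKernel s' y|
      ≤ ∫ y : E, (heatKernel s y + heatKernel s' y - 2 * (ρ * heatKernel s y)) :=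
        integral_mono habs (hsum.sub h2ρ) fun y => hpt y
    _ = 2 * (1 - ρ) := by
        rw [integral_sub hsum h2ρ, integral_add hi hi',
          integral_const_mul, integral_const_mul,
          UnboundedOperators.integral_heatKernel_eq_one_holds hs,
          UnboundedOperators.integral_heatKernel_eq_one_holds hs']
        ring

/-- **Large-time continuity of the heat flow on bounded continuous data**: if `‖g‖ ≤ C` then for
`0 < s ≤ s'` and every `x`, `‖e^{sΔ}g(x) − e^{s'Δ}g(x)‖ ≤ 2(1 − (s/s')^{n/2}) C`
(`integral_abs_heatKernel_sub_le`). [folklore] -/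
theorem norm_heatExtension_sub_heatExtension_le_rpow {g : E → F} (hg : Continuous g) {C : ℝ}
    (hC : ∀ z, ‖g z‖ ≤ C) {s s' : ℝ} (hs : 0 < s) (hss' : s ≤ s') (x : E) :
    ‖heatExtension g s x - heatExtension g s' x‖ ≤
      2 * (1 - (s / s') ^ ((Module.finrank ℝ E : ℝ) / 2)) * C := by
  have hs' : 0 < s' := hs.trans_le hss'
  have hC0 : 0 ≤ C := (norm_nonneg _).trans (hC x)
  have hi : Integrable (heatKernel (E := E) s) := UnboundedOperators.integrable_heatKernel_holds hs
  have hi' : Integrable (heatKernel (E := E) s') := UnboundedOperators.integrable_heatKernel_holds hs'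
  have hsub : heatExtension g s x - heatExtension g s' x =
      ∫ y, (heatKernel s y - heatKernel s' y) • g (x - y) := by
    rw [UnboundedOperators.heatExtension_apply, UnboundedOperators.heatExtension_apply,
      ← integral_sub (UnboundedOperators.integrable_heatKernel_smul_of_bound hg hC hs x)
        (UnboundedOperators.integrable_heatKernel_smul_of_bound hg hC hs' x)]
    simp_rw [sub_smul]
  rw [hsub]
  have habs : Integrable (fun y : E => |heatKernel s y - heatKernel s' y|) := (hi.sub hi').abs
  have hint : Integrable (fun y : E => |heatKernel s y - heatKernel s' y| * C) := habs.mul_const C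
  calc ‖∫ y, (heatKernel s y - heatKernel s' y) • g (x - y)‖
      ≤ ∫ y, |heatKernel s y - heatKernel s' y| * C := by
        refine norm_integral_le_of_norm_le hint (Eventually.of_forall fun y => ?_)
        rw [norm_smul, Real.norm_eq_abs]
        exact mul_le_mul_of_nonneg_left (hC _) (abs_nonneg _)
    _ = (∫ y, |heatKernel s y - heatKernel s' y|) * C := integral_mul_const _ _
    _ ≤ 2 * (1 - (s / s') ^ ((Module.finrank ℝ E : ℝ) / 2)) * C :=
        mul_le_mul_of_nonneg_right (integral_abs_heatKernel_sub_le hs hss') hC0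

/-- **The heat flow forgets a fixed time lag**: for bounded continuous `g`, `τ > 0` and `d ≥ 0`,
`e^{(τ+σ)Δ}g(x) − e^{(τ+d+σ)Δ}g(x) → 0` as `σ → ∞`. [folklore] -/
theorem tendsto_heatExtension_sub_heatExtension_lag {g : E → F} (hg : Continuous g) {C : ℝ}
    (hC : ∀ z, ‖g z‖ ≤ C) {τ d : ℝ} (hτ : 0 < τ) (hd : 0 ≤ d) (x : E) :
    Tendsto (fun σ : ℝ => heatExtension g (τ + σ) x - heatExtension g (τ + d + σ) x) atTop (𝓝 0) := by
  set e : ℝ := (Module.finrank ℝ E : ℝ) / 2 with he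
  -- the ratio `(τ + σ)/(τ + d + σ) → 1`
  have hratio : Tendsto (fun σ : ℝ => (τ + σ) / (τ + d + σ)) atTop (𝓝 1) := by
    have h1 : Tendsto (fun σ : ℝ => d / (τ + d + σ)) atTop (𝓝 0) :=
      tendsto_const_nhds.div_atTop (tendsto_atTop_add_const_left _ _ tendsto_id)
    have h2 : Tendsto (fun σ : ℝ => 1 - d / (τ + d + σ)) atTop (𝓝 (1 - 0)) :=
      tendsto_const_nhds.sub h1
    rw [sub_zero] at h2
    refine h2.congr' ?_
    filter_upwards [eventually_gt_atTop 0] with σ hσ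
    have hpos : 0 < τ + d + σ := by linarith
    field_simp
    ring
  have hpow : Tendsto (fun σ : ℝ => ((τ + σ) / (τ + d + σ)) ^ e) atTop (𝓝 1) := by
    have := hratio.rpow_const (p := e) (Or.inl one_ne_zero)
    rwa [Real.one_rpow] at this
  have hbound : Tendsto (fun σ : ℝ => 2 * (1 - ((τ + σ) / (τ + d + σ)) ^ e) * C) atTop (𝓝 0) := by
    have := (((tendsto_const_nhds (x := (1 : ℝ))).sub hpow).const_mul 2).mul_const C
    simpa using this
  refine squeeze_zero_norm' ?_ hbound
  filter_upwards [eventually_gt_atTop 0] with σ hσ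
  exact norm_heatExtension_sub_heatExtension_le_rpow hg hC (by linarith) (by linarith) x

/-- Symmetric form of `tendsto_heatExtension_sub_heatExtension_lag`: for bounded continuous `g` and
`τ, τ' > 0`, `e^{(τ+σ)Δ}g(x) − e^{(τ'+σ)Δ}g(x) → 0` as `σ → ∞`. [folklore] -/
theorem tendsto_heatExtension_sub_heatExtension {g : E → F} (hg : Continuous g) {C : ℝ}
    (hC : ∀ z, ‖g z‖ ≤ C) {τ τ' : ℝ} (hτ : 0 < τ) (hτ' : 0 < τ') (x : E) :
    Tendsto (fun σ : ℝ => heatExtension g (τ + σ) x - heatExtension g (τ' + σ) x) atTop (𝓝 0) := by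
  rcases le_total τ τ' with h | h
  · have key := tendsto_heatExtension_sub_heatExtension_lag hg hC hτ (sub_nonneg.2 h) x
    refine key.congr fun σ => ?_
    rw [show τ + (τ' - τ) + σ = τ' + σ by ring]
  · have key := (tendsto_heatExtension_sub_heatExtension_lag hg hC hτ' (sub_nonneg.2 h) x).neg
    rw [neg_zero] at key
    refine key.congr fun σ => ?_
    rw [show τ' + (τ - τ') + σ = τ + σ by ring, neg_sub]

end HeatKernel

/-! ### Bounded steady solutions are Oseen-mild -/

section Steady

/-- **Bounded steady weak solutions on `ℝ³` are Oseen-mild** (the form of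
`IsSteadyClassicalNS.eq_heatExtension_sub_oseenDuhamel` that uses only what its proof uses: a
CONTINUOUS bounded field `W` whose constant-in-time extension is a bounded weak Navier–Stokes
solution on every `(0, T)`; no smoothness, no pressure). For every `τ > 0` and every `x`,
`W(x) = e^{τΔ}W(x) − B¹₀(W, W)(τ)(x)`. Proof: KNSS's Lemma 3.1 (drift-mild decomposition) and the
steady drift kill of the module docstring. [cite: KochNadirashviliSereginSverak2009, §3 Lemma 3.1 and §1 p. 3 (arXiv:0709.3599)] -/
theorem eq_heatExtension_sub_oseenDuhamel_of_isBoundedWeakNSSolutionOn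
    {W : EuclideanSpace ℝ (Fin 3) → EuclideanSpace ℝ (Fin 3)} (hWc : Continuous W)
    {M : ℝ} (hM : ∀ x, ‖W x‖ ≤ M)
    (hweakT : ∀ T : ℝ, 0 < T → IsBoundedWeakNSSolutionOn (Ioo 0 T) isOpen_Ioo 1 (fun _ : ℝ => W))
    {τ : ℝ} (hτ : 0 < τ) (x : EuclideanSpace ℝ (Fin 3)) :
    W x = heatExtension W τ x - oseenDuhamel 1 0 (fun _ : ℝ => W) (fun _ : ℝ => W) τ x := by
  classical
  have hM0 : 0 ≤ M := (norm_nonneg _).trans (hM 0)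
  set T : ℝ := τ + 1 with hT
  have hT0 : 0 < T := by rw [hT]; linarith
  have hτT : τ < T := by rw [hT]; linarith
  set u : ℝ → EuclideanSpace ℝ (Fin 3) → EuclideanSpace ℝ (Fin 3) := fun _ => W
  -- ### Step 1: bounded weak on `(0, T)`, Lemma 3.1
  have hweak : IsBoundedWeakNSSolutionOn (Ioo 0 T) isOpen_Ioo 1 u := hweakT T hT0
  obtain ⟨N, hN⟩ := KNSS2009_weak_driftMild_holds M T hT0
  obtain ⟨U, bd, hUb, hae⟩ := hN hweak fun _ _ y => hM y
  set G : Set ℝ := {r | r ∈ Ioo 0 T ∧ (W =ᵐ[volume] fun y => U r y + bd r)}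
  have hGae : ∀ᵐ r ∂((volume : Measure ℝ).restrict (Ioo 0 T)), r ∈ G := by
    filter_upwards [hae, ae_restrict_mem measurableSet_Ioo] with r h1 h2
    exact ⟨h2, h1⟩
  have hUslice : ∀ σ, Measurable (U σ) := fun σ =>
    hUb.measurable.comp (measurable_const.prodMk measurable_id)
  -- the drift-free field `Φ(τ) = e^{τΔ}W − B¹₀(W,W)(τ)`
  set Φ : ℝ → EuclideanSpace ℝ (Fin 3) → EuclideanSpace ℝ (Fin 3) := fun σ y =>
    heatExtension W σ y - oseenDuhamel 1 0 u u σ y with hΦ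
  -- ### Step 2: the representation with drift at good initial times
  have hA : ∀ r ∈ G, ∀ t' : ℝ, r < t' → t' < T → ∀ y, U t' y = Φ (t' - r) y - bd r := by
    intro r hr t' hrt' ht' y
    have hr0 : 0 < r := hr.1.1
    have hmild := hUb.mild r t' hr0 hrt' ht' y
    have hcal : heatExtension (U r) (t' - r) y = heatExtension W (t' - r) y - bd r := by
      have hae_r : U r =ᵐ[volume] fun z => W z - bd r := by
        filter_upwards [hr.2] with z hz
        rw [hz]; abel
      rw [UnboundedOperators.heatExtension_congr_ae' hae_r,
        UnboundedOperators.heatExtension_sub_of_bound hWc continuous_const hM (fun _ => le_rfl)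
          (sub_pos.2 hrt') y,
        UnboundedOperators.heatExtension_const _ (sub_pos.2 hrt') y]
    have hduh : driftDuhamel U bd r t' y = oseenDuhamel 1 0 u u (t' - r) y := by
      have hNN : ∀ σ ∈ Ioo r t', ∀ z, ‖U σ z + bd σ‖ ≤ N + N := fun σ hσ z =>
        (norm_add_le _ _).trans (add_le_add (hUb.norm_le σ ⟨hr0.trans hσ.1, hσ.2.trans ht'⟩ z)
          (hUb.norm_drift_le σ))
      rw [driftDuhamel_eq_oseenDuhamel_drift (fun σ _ => hUslice σ) hNN hrt'.le y]
      have h1 : oseenDuhamel 1 r (fun σ z => U σ z + bd σ) (fun σ z => U σ z + bd σ) t' y =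
          oseenDuhamel 1 r u u t' y := by
        refine oseenDuhamel_congr_ae_slices ?_ y
        have hsub : Ioo r t' ⊆ Ioo 0 T := Ioo_subset_Ioo hr0.le ht'.le
        filter_upwards [ae_restrict_of_ae_restrict_of_subset hsub hae] with σ hσ
        exact hσ.symm
      rw [h1]
      have h2 := oseenDuhamel_translate 1 0 r u u (t' - r) y
      simp only [zero_add, sub_add_cancel] at h2
      exact h2.symm
    rw [hmild, hcal, hduh]
    simp only [hΦ]
    abel
  -- ### Step 3: continuity and bounds of the drift-free field
  have hmeasu : ∀ a b : ℝ, AEStronglyMeasurable (uncurry u)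
      ((volume : Measure (ℝ × EuclideanSpace ℝ (Fin 3))).restrict (Ioo a b ×ˢ univ)) :=
    fun a b => (hWc.comp continuous_snd).aestronglyMeasurable
  obtain ⟨CB, hCB0, hCB⟩ := exists_norm_oseenDuhamel_bounded_le (E := EuclideanSpace ℝ (Fin 3))
  have hheat_cont : ∀ σ : ℝ, 0 < σ → Continuous (heatExtension W σ) := fun σ hσ =>
    (UnboundedOperators.contDiff_heatExtension_holds
      (UnboundedOperators.memLp_top_of_continuous_of_bound hWc hM) le_top hσ).continuous
  have hheat_bd : ∀ σ : ℝ, 0 < σ → ∀ y, ‖heatExtension W σ y‖ ≤ M := fun σ hσ y =>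
    UnboundedOperators.norm_heatExtension_le hM hσ y
  have hduh_cont : ∀ σ : ℝ, 0 < σ → Continuous (oseenDuhamel 1 0 u u σ) := fun σ hσ =>
    continuous_oseenDuhamel_slice one_pos hM0 (hmeasu 0 σ) (hmeasu 0 σ) (fun _ _ y => hM y)
      (fun _ _ y => hM y) hσ le_rfl
  have hduh_bd : ∀ σ : ℝ, 0 < σ → ∀ y, ‖oseenDuhamel 1 0 u u σ y‖ ≤
      CB * M ^ 2 * (1 : ℝ) ^ (-(1 / 2 : ℝ)) * (2 * Real.sqrt (σ - 0)) := fun σ hσ y =>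
    hCB one_pos hσ hM0 (fun _ _ y => hM y) (fun _ _ y => hM y) y
  have hΦc : ∀ σ : ℝ, 0 < σ → Continuous (Φ σ) := fun σ hσ =>
    (hheat_cont σ hσ).sub (hduh_cont σ hσ)
  have hΦb : ∀ σ : ℝ, 0 < σ → ∀ y, ‖Φ σ y‖ ≤
      M + CB * M ^ 2 * (1 : ℝ) ^ (-(1 / 2 : ℝ)) * (2 * Real.sqrt (σ - 0)) := fun σ hσ y =>
    (norm_sub_le _ _).trans (add_le_add (hheat_bd σ hσ y) (hduh_bd σ hσ y))
  -- the heat flow of `Φ(τ)`: `e^{σΔ}Φ(τ) = e^{(τ+σ)Δ}W − e^{σΔ}B¹₀(W,W)(τ)`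
  have hheatΦ : ∀ ⦃σ : ℝ⦄, 0 < σ → ∀ ⦃ρ : ℝ⦄, 0 < ρ → ∀ z, heatExtension (Φ ρ) σ z =
      heatExtension W (ρ + σ) z - heatExtension (oseenDuhamel 1 0 u u ρ) σ z := by
    intro σ hσ ρ hρ z
    have hadd := UnboundedOperators.heatExtension_add_holds
      (UnboundedOperators.memLp_top_of_continuous_of_bound hWc hM) le_top hρ hσ
    show heatExtension (fun y => heatExtension W ρ y - oseenDuhamel 1 0 u u ρ y) σ z = _
    rw [UnboundedOperators.heatExtension_sub_of_bound (hheat_cont ρ hρ) (hduh_cont ρ hρ)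
      (hheat_bd ρ hρ) (hduh_bd ρ hρ) hσ z, ← hadd]
  -- ### Step 4: the drift is constant on the good times (steady drift kill)
  have hB : ∀ r₁ ∈ G, ∀ r₂ ∈ G, bd r₁ = bd r₂ := by
    intro r₁ hr₁ r₂ hr₂
    set t' : ℝ := (max r₁ r₂ + T) / 2 with ht'
    have hmax : max r₁ r₂ < T := max_lt hr₁.1.2 hr₂.1.2
    have h1t' : r₁ < t' := by rw [ht']; linarith [le_max_left r₁ r₂]
    have h2t' : r₂ < t' := by rw [ht']; linarith [le_max_right r₁ r₂]
    have ht'T : t' < T := by rw [ht']; linarith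
    set τ₁ : ℝ := t' - r₁
    set τ₂ : ℝ := t' - r₂
    have hτ₁0 : 0 < τ₁ := sub_pos.2 h1t'
    have hτ₂0 : 0 < τ₂ := sub_pos.2 h2t'
    have key : ∀ y, bd r₂ - bd r₁ = Φ τ₂ y - Φ τ₁ y := by
      intro y
      have e1 := hA r₁ hr₁ t' h1t' ht'T y
      have e2 := hA r₂ hr₂ t' h2t' ht'T y
      rw [e1] at e2
      have e3 := sub_eq_sub_iff_sub_eq_sub.1 e2
      rw [← neg_sub (bd r₁), ← e3, neg_sub]
    set c : EuclideanSpace ℝ (Fin 3) := bd r₂ - bd r₁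
    suffices hc0 : c = 0 by exact (sub_eq_zero.1 hc0).symm
    -- decay of the heat flow of the two Duhamel pieces
    obtain ⟨C₁, hC₁⟩ := exists_norm_heatExtension_oseenDuhamel_le_of_bound (hmeasu 0 τ₁) (hmeasu 0 τ₁)
      hM0 (fun _ _ y => hM y) (fun _ _ y => hM y) hτ₁0
    obtain ⟨C₂, hC₂⟩ := exists_norm_heatExtension_oseenDuhamel_le_of_bound (hmeasu 0 τ₂) (hmeasu 0 τ₂)
      hM0 (fun _ _ y => hM y) (fun _ _ y => hM y) hτ₂0
    set x₀ : EuclideanSpace ℝ (Fin 3) := 0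
    have hbound : ∀ᶠ σ : ℝ in atTop, ‖c‖ ≤
        ‖heatExtension W (τ₂ + σ) x₀ - heatExtension W (τ₁ + σ) x₀‖ +
          (C₂ * σ ^ (-(1 / 2 : ℝ)) + C₁ * σ ^ (-(1 / 2 : ℝ))) := by
      filter_upwards [eventually_gt_atTop 0] with σ hσ
      have ec : heatExtension (fun _ : EuclideanSpace ℝ (Fin 3) => c) σ x₀ = c :=
        UnboundedOperators.heatExtension_const c hσ x₀
      have efun : (fun _ : EuclideanSpace ℝ (Fin 3) => c) = fun y => Φ τ₂ y - Φ τ₁ y := funext key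
      have ediff : heatExtension (fun y => Φ τ₂ y - Φ τ₁ y) σ x₀ =
          heatExtension (Φ τ₂) σ x₀ - heatExtension (Φ τ₁) σ x₀ :=
        UnboundedOperators.heatExtension_sub_of_bound (hΦc τ₂ hτ₂0) (hΦc τ₁ hτ₁0) (hΦb τ₂ hτ₂0)
          (hΦb τ₁ hτ₁0) hσ x₀
      have hc_eq : c = (heatExtension W (τ₂ + σ) x₀ - heatExtension (oseenDuhamel 1 0 u u τ₂) σ x₀) -
          (heatExtension W (τ₁ + σ) x₀ - heatExtension (oseenDuhamel 1 0 u u τ₁) σ x₀) := by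
        rw [← ec, efun, ediff, hheatΦ hσ hτ₂0, hheatΦ hσ hτ₁0]
      calc ‖c‖ = ‖(heatExtension W (τ₂ + σ) x₀ - heatExtension W (τ₁ + σ) x₀) -
            (heatExtension (oseenDuhamel 1 0 u u τ₂) σ x₀ -
              heatExtension (oseenDuhamel 1 0 u u τ₁) σ x₀)‖ := by
            rw [hc_eq]; congr 1; abel
        _ ≤ ‖heatExtension W (τ₂ + σ) x₀ - heatExtension W (τ₁ + σ) x₀‖ +
            ‖heatExtension (oseenDuhamel 1 0 u u τ₂) σ x₀ -
              heatExtension (oseenDuhamel 1 0 u u τ₁) σ x₀‖ := norm_sub_le _ _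
        _ ≤ ‖heatExtension W (τ₂ + σ) x₀ - heatExtension W (τ₁ + σ) x₀‖ +
            (‖heatExtension (oseenDuhamel 1 0 u u τ₂) σ x₀‖ +
              ‖heatExtension (oseenDuhamel 1 0 u u τ₁) σ x₀‖) := by
            gcongr; exact norm_sub_le _ _
        _ ≤ ‖heatExtension W (τ₂ + σ) x₀ - heatExtension W (τ₁ + σ) x₀‖ +
            (C₂ * σ ^ (-(1 / 2 : ℝ)) + C₁ * σ ^ (-(1 / 2 : ℝ))) := by
            gcongr
            · exact hC₂ hσ x₀
            · exact hC₁ hσ x₀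
    have hlim : Tendsto (fun σ : ℝ => ‖heatExtension W (τ₂ + σ) x₀ - heatExtension W (τ₁ + σ) x₀‖ +
        (C₂ * σ ^ (-(1 / 2 : ℝ)) + C₁ * σ ^ (-(1 / 2 : ℝ)))) atTop (𝓝 0) := by
      have h1 := (tendsto_heatExtension_sub_heatExtension hWc hM hτ₂0 hτ₁0 x₀).norm
      have h2 : Tendsto (fun σ : ℝ => σ ^ (-(1 / 2 : ℝ))) atTop (𝓝 0) :=
        tendsto_rpow_neg_atTop (by norm_num)
      have := h1.add ((h2.const_mul C₂).add (h2.const_mul C₁))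
      simpa using this
    exact norm_le_zero_iff.1 (ge_of_tendsto hlim hbound)
  -- ### Step 5: good pairs
  have hC : ∀ r ∈ G, ∀ t' ∈ G, r < t' → ∀ y, W y = Φ (t' - r) y := by
    intro r hr t' ht' hrt' y
    have hae' : W =ᵐ[volume] Φ (t' - r) := by
      filter_upwards [ht'.2] with z hz
      rw [hz, hA r hr t' hrt' ht'.1.2 z, hB r hr t' ht', sub_add_cancel]
    exact congrFun ((Continuous.ae_eq_iff_eq volume hWc (hΦc _ (sub_pos.2 hrt'))).1 hae') y
  -- ### Step 6: `τ` is the difference of two good times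
  obtain ⟨r, hrG, hrτG⟩ : ∃ r, r ∈ G ∧ r + τ ∈ G := by
    have h1 : ∀ᵐ r ∂(volume : Measure ℝ), r ∈ Ioo 0 T → r ∈ G :=
      (ae_restrict_iff' measurableSet_Ioo).1 hGae
    have h2 : ∀ᵐ r ∂(volume : Measure ℝ), r + τ ∈ Ioo 0 T → r + τ ∈ G := by
      have hnull : volume {r : ℝ | ¬ (r ∈ Ioo 0 T → r ∈ G)} = 0 := ae_iff.1 h1
      have hpre : volume ((fun r : ℝ => r + τ) ⁻¹' {r : ℝ | ¬ (r ∈ Ioo 0 T → r ∈ G)}) = 0 := by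
        rw [measure_preimage_add_right]; exact hnull
      exact ae_iff.2 hpre
    have h3 : ∀ᵐ r ∂((volume : Measure ℝ).restrict (Ioo 0 (T - τ))),
        r ∈ {r : ℝ | r ∈ G ∧ r + τ ∈ G} := by
      filter_upwards [ae_restrict_of_ae (s := Ioo 0 (T - τ)) h1,
        ae_restrict_of_ae (s := Ioo 0 (T - τ)) h2, ae_restrict_mem measurableSet_Ioo] with r g1 g2 hr
      exact ⟨g1 ⟨hr.1, by linarith [hr.2]⟩, g2 ⟨by linarith [hr.1], by linarith [hr.2]⟩⟩
    obtain ⟨r, -, hr⟩ := exists_mem_Ioo_of_ae_mem h3 le_rfl (by linarith : (0 : ℝ) < T - τ) le_rfl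
    exact ⟨r, hr.1, hr.2⟩
  have key := hC r hrG (r + τ) hrτG (by linarith) x
  rw [add_sub_cancel_left] at key
  simpa only [hΦ] using key

/-- **Bounded steady Navier–Stokes flows on `ℝ³` are Oseen-mild.** Let `(W, P)` be a steady
classical solution of the unforced Navier–Stokes system at unit viscosity on `ℝ³`
(`IsSteadyClassicalNS 1 0 W P`) with `‖W‖ ≤ M`. Then for every `τ > 0` and every `x`,
`W(x) = e^{τΔ}W(x) − B¹₀(W, W)(τ)(x)`: the steady field solves Oseen's integral equation from
its own datum. Proof: KNSS's Lemma 3.1 (drift-mild decomposition of the bounded weak solution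
`u(t) = W`) and the steady drift kill of the module docstring (heat flow to large times); no
hypothesis on the pressure is needed (Koch–Nadirashvili–Seregin–Šverák 2009, Lemma 3.1 and §1
p. 3; the finite-energy / decaying twins are `mild_of_bounded_of_eLpNorm_two_le_of_lt`,
`mild_of_rMulNorm_bounded_of_lt`). [cite: KochNadirashviliSereginSverak2009, §3 Lemma 3.1 and §1 p. 3 (arXiv:0709.3599)] -/
theorem IsSteadyClassicalNS.eq_heatExtension_sub_oseenDuhamel {W : EuclideanSpace ℝ (Fin 3) → EuclideanSpace ℝ (Fin 3)}
    {P : EuclideanSpace ℝ (Fin 3) → ℝ}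
    (h : IsSteadyClassicalNS 1 0 W P) {M : ℝ} (hM : ∀ x, ‖W x‖ ≤ M) {τ : ℝ} (hτ : 0 < τ)
    (x : EuclideanSpace ℝ (Fin 3)) :
    W x = heatExtension W τ x - oseenDuhamel 1 0 (fun _ : ℝ => W) (fun _ : ℝ => W) τ x := by
  refine eq_heatExtension_sub_oseenDuhamel_of_isBoundedWeakNSSolutionOn
    h.smooth_velocity.continuous hM (fun T _ => ?_) hτ x
  have hcl : IsClassicalNSSolutionOn (Ioo 0 T) 1 0 (fun _ : ℝ => W) (fun _ : ℝ => P) :=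
    (isSteadyClassicalNS_iff_const.1 h).mono (subset_univ _) (uniqueDiffOn_Ioo 0 T)
  exact hcl.isBoundedWeakNSSolutionOn ⟨M, fun _ _ y => hM y⟩

end Steady

end Literature.Analysis.FluidPDE

end
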